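import Summits.ResolutionOfSingularities.ResolutionOfSingularities.Theorems.WeightedInvariantPointDrop
import Summits.ResolutionOfSingularities.ResolutionOfSingularities.Theorems.WeightedInvariantCobordantTGrading
import Summits.ResolutionOfSingularities.ResolutionOfSingularities.Theorems.WeightedInvariantHomogeneousRegularParameters
import HarnessLib

/-!
# (K-wild-hom) — THE STATEMENT: the (drop) conjunct RESTRICTED TO `t`-HOMOGENEOUS SUCCESSOR PRIMES, with NO tameness cut
# (door `HypersurfaceCentreConstruction`, stmt-ResolutionOfSingularities-19897; P3 rung; (c9′)≤3 ISOLATED/TIE at WILD weights; ORDER (o50) and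
# RULING gen 11 #9 (ii) of res-L1-w43-plan-1; memo `plan/tools/res-type-060/o50/K-WILD-HOM.md` §3, design of record; typer res-type-060)

Topic: `Summits/ResolutionOfSingularities/ResolutionOfSingularities/Theorems`.  STATEMENT MODULE (definitions of `Prop`s + trivial seams; NO proof
of any drop):
* `IsTHomogeneous u w 𝔫` — «the ideal `𝔫` of the cobordant algebra `cobordantAlgebra' u w = S[t⁻¹, uᵢt^{wᵢ}]` is `t`-HOMOGENEOUS»: it is spanned by
  its `t`-homogeneous elements (instance-free; `tGrading` of p539199 `…CobordantTGrading`); `isTHomogeneous_iff_isHomogeneous`: under the graded-ring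
  structure `nonempty_gradedRing_tGrading` this is Mathlib's `Ideal.IsHomogeneous`.
* `WeightedDropHom ι S f P u w` — `WeightedDrop` (p-file `…P3bDrop`, body verbatim) with the successor quantifier RESTRICTED to `t`-homogeneous primes
  `𝔫` (RULING #8: the restricted successor quantifier is permitted; the inhomogeneous successors — closed points of torus orbits, 4-dimensional local
  rings — are read through the cylinder over the orbit-generic HOMOGENEOUS prime by res-type-073's (S2) and 057's (c10)/(c11) equality along orbits,
  a tameness-free reduction).  Seam `WeightedDrop.toHom`.
* `Iota3.KWildHomOf Pos ι p` — `Iota3.PointDropOf Pos Tame ι p` with the tameness hypothesis DELETED and the conclusion `WeightedDropHom`: the typed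
  (c9′)≤3-WILD target of record (of record: `Pos = IsIsolatedPosition ∨ IsTiePosition`, `ι = iotaFlatT`).  Seams: `KWildHomOf.mono_pos`, and
  `kWildHomOf_of_pointDropOf_true` (a tameness-free `PointDropOf` gives it).
* `exists_homogeneous_regularParameters_cobordant` — (H1) (p538457) INSTANTIATED at the door's carrier: every `t`-homogeneous prime `𝔫` of
  `cobordantAlgebra' u w` with regular local ring has a regular system of parameters of `t`-homogeneous elements (`S` noetherian).
WHY IT MIGHT HOLD (memo §4, the K1 specimen `x² + y⁷ + yz⁴ / 𝔽₂` by hand: unique homogeneous singular successor `η = (T, X, Z)`, `σ₁` drops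
`5/2 → 2` because `√Y ∉ κ(η) = 𝔽₂(Y)`, `(ν;ε;τ)` equal); WHY IT MIGHT FAIL (res-L1-w43-tri-2 F9-wild / res-L1-w43-idea-2 R7: a wild isolated start
whose orbit-generic homogeneous successor carries a homogeneous flag with `σ ≥ σ(S, f)` at equal `(ν;ε;τ)`).  NOTHING of this is proved here.
[OURS · candidates · conjecture-grade statement of OUR key's rung; NOT a statement of the manuscript under review (Hironaka 2017); AI typing,
weaker than expert review.]
-/

noncomputable section

open IsLocalRing Literature.AlgebraicGeometry.Resolution
open Summit.ResolutionOfSingularities.ResolutionOfSingularities.Theorems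

set_option linter.dupNamespace false -- mandated namespace of this single-conjunct summit

namespace Summit.ResolutionOfSingularities.ResolutionOfSingularities.Cruxes.HypersurfaceCentreConstruction.LocalEngine

/-! ## `t`-homogeneous ideals of the cobordant algebra -/

section THom

variable {S : Type} [CommRing S] {n : ℕ} (u : Fin n → S) (w : Fin n → ℕ)

/-- [OURS · (o50)] **`𝔫` is `t`-HOMOGENEOUS**: the ideal `𝔫` of `cobordantAlgebra' u w ⊆ S[t, t⁻¹]` is spanned by its elements of pure `t`-degree
(instance-free form of Mathlib's `Ideal.IsHomogeneous` for the `t`-grading `KWildHom.tGrading u w`, p539199).  A predicate of the line. -/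
def IsTHomogeneous (𝔫 : Ideal (cobordantAlgebra' u w)) : Prop :=
  Ideal.span {x | x ∈ 𝔫 ∧ SetLike.IsHomogeneousElem (KWildHom.tGrading u w) x} = 𝔫

/-- Under the graded-ring structure of p539199 (`KWildHom.nonempty_gradedRing_tGrading`), `IsTHomogeneous` is Mathlib's `Ideal.IsHomogeneous`.
[folklore] -/
theorem isTHomogeneous_iff_isHomogeneous [GradedRing (KWildHom.tGrading u w)] (𝔫 : Ideal (cobordantAlgebra' u w)) :
    IsTHomogeneous u w 𝔫 ↔ 𝔫.IsHomogeneous (KWildHom.tGrading u w) := by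
  refine ⟨fun h => ?_, fun h => KWildHom.span_homogeneous_inter_eq _ h⟩
  rw [← h]
  exact Ideal.homogeneous_span _ _ fun x hx => hx.2

end THom

/-! ## The (drop) conjunct restricted to `t`-homogeneous successors -/

/-- [OURS · (o50) · RULING gen 11 #9 (ii)] **The (drop) conjunct at `t`-HOMOGENEOUS successor primes** — `WeightedDrop` (body verbatim) with the
quantifier over the primes `𝔫` of the cobordant algebra restricted to the `t`-homogeneous ones: at every `t`-homogeneous prime `𝔫 ∋ t⁻¹`, over `P`,
off the vertex, and every `f = (t⁻¹)^a · g` with `t⁻¹ ∤ g` and `g/1 ∈ 𝔪_𝔫²`: `ι (B_𝔫) (g/1) < ι S f`.  A predicate of the line (the clause text,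
restricted), not a cited statement. -/
def WeightedDropHom (ι : (R : Type) → [CommRing R] → R → Ordinal.{0}) (S : Type) [CommRing S] (f : S) (P : Ideal S) {n : ℕ}
    (u : Fin n → S) (w : Fin n → ℕ) : Prop :=
  ∀ (𝔫 : Ideal (cobordantAlgebra' u w)) [𝔫.IsPrime],
    IsTHomogeneous u w 𝔫 →
    cobordantT' u w ∈ 𝔫 →
    P.map (algebraMap S (cobordantAlgebra' u w)) ≤ 𝔫 →
    ¬ (extReesAlgebra.vertexIdeal (weightedMonomialIdeal u w) ≤ 𝔫) →
    ∀ (a : ℕ) (g : cobordantAlgebra' u w),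
      algebraMap S (cobordantAlgebra' u w) f = cobordantT' u w ^ a * g →
      ¬ (cobordantT' u w ∣ g) →
      algebraMap (cobordantAlgebra' u w) (Localization.AtPrime 𝔫) g ∈
        (maximalIdeal (Localization.AtPrime 𝔫)) ^ 2 →
      ι (Localization.AtPrime 𝔫) (algebraMap (cobordantAlgebra' u w) (Localization.AtPrime 𝔫) g) < ι S f

/-- **Restriction seam**: the full (drop) conjunct gives the homogeneous one. [folklore] -/
theorem WeightedDrop.toHom {ι : (R : Type) → [CommRing R] → R → Ordinal.{0}} {S : Type} [CommRing S] {f : S} {P : Ideal S} {n : ℕ}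
    {u : Fin n → S} {w : Fin n → ℕ} (h : WeightedDrop ι S f P u w) : WeightedDropHom ι S f P u w :=
  fun 𝔫 _ _ hT hP hv a g hfac hndvd hsing => h 𝔫 hT hP hv a g hfac hndvd hsing

/-- **Monotonicity in the invariant** (as `WeightedDrop.mono`). [folklore] -/
theorem WeightedDropHom.mono {ι ι' : (R : Type) → [CommRing R] → R → Ordinal.{0}} {S : Type} [CommRing S] {f : S} {P : Ideal S} {n : ℕ}
    {u : Fin n → S} {w : Fin n → ℕ} (h : WeightedDropHom ι S f P u w)
    (hle : ∀ (𝔫 : Ideal (cobordantAlgebra' u w)) [𝔫.IsPrime] (g : cobordantAlgebra' u w),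
      ι' (Localization.AtPrime 𝔫) (algebraMap (cobordantAlgebra' u w) (Localization.AtPrime 𝔫) g) ≤
        ι (Localization.AtPrime 𝔫) (algebraMap (cobordantAlgebra' u w) (Localization.AtPrime 𝔫) g))
    (heq : ι S f ≤ ι' S f) : WeightedDropHom ι' S f P u w :=
  fun 𝔫 _ hh hT hP hv a g hfac hndvd hsing => (hle 𝔫 g).trans_lt ((h 𝔫 hh hT hP hv a g hfac hndvd hsing).trans_le heq)

namespace Iota3

/-- [OURS · (o50) · candidate · conjecture-grade] **(K-wild-hom), parametric in the position class and the invariant**: `PointDropOf Pos · ι p`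
with the TAMENESS HYPOTHESIS DELETED and the conclusion RESTRICTED to `t`-homogeneous successors — at every position `S` (regular local, essentially
of finite type over a perfect field of characteristic `p`, `dim S ≤ 3`), every `0 ≠ f ∈ 𝔪²` with `Pos S f`, every σ-attaining two-flag
`(g₁, g₂; q, r₁, r₂)` with primitive weights (ANY weights — divisible by `p` or not) completed by `x` to an r.s.p. `(x, g₂, g₁)`:
`WeightedDropHom ι S f 𝔪 ![x, g₂, g₁] ![q, r₂, r₁]`.  Of record: `Pos = IsIsolatedPosition ∨ IsTiePosition`, `ι = iotaFlatT`. -/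
def KWildHomOf (Pos : (R : Type) → [CommRing R] → [IsLocalRing R] → R → Prop) (ι : (R : Type) → [CommRing R] → R → Ordinal.{0}) (p : ℕ) : Prop :=
  ∀ (k₀ : Type) [Field k₀] [CharP k₀ p] [PerfectField k₀]
    (S : Type) [CommRing S] [Algebra k₀ S] [Algebra.EssFiniteType k₀ S] [IsRegularLocalRing S] (f : S),
    ringKrullDim S ≤ 3 → f ≠ 0 → f ∈ (maximalIdeal S) ^ 2 →
    Pos S f →
    ∀ (ν : ℕ), iotaOrd S f = ν →
    ∀ (x g₁ g₂ : S) (q r₁ r₂ : ℕ),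
      Ideal.span {x, g₂, g₁} = maximalIdeal S → (maximalIdeal S).spanFinrank = 3 →
      IsSigmaMaximiser f ν g₁ g₂ q r₁ r₂ → IsPrimitiveTriple q r₁ r₂ →
      WeightedDropHom ι S f (maximalIdeal S) ![x, g₂, g₁] ![q, r₂, r₁]

namespace KWildHomOf

variable {Pos Pos' : (R : Type) → [CommRing R] → [IsLocalRing R] → R → Prop} {ι : (R : Type) → [CommRing R] → R → Ordinal.{0}} {p : ℕ}

/-- A SMALLER position class gives a WEAKER statement. [folklore] -/
theorem mono_pos (hP : ∀ (R : Type) [CommRing R] [IsLocalRing R] (g : R), Pos' R g → Pos R g) (h : KWildHomOf Pos ι p) :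
    KWildHomOf Pos' ι p :=
  fun k₀ _ _ _ S _ _ _ _ f hdim hf0 hf2 hpos ν hν x g₁ g₂ q r₁ r₂ hspan hrk hmax hprim =>
    h k₀ S f hdim hf0 hf2 (hP S f hpos) ν hν x g₁ g₂ q r₁ r₂ hspan hrk hmax hprim

/-- ONE proof serves two rows (ISOLATED ∨ TIE). [folklore] -/
theorem union (h : KWildHomOf Pos ι p) (h' : KWildHomOf Pos' ι p) : KWildHomOf (fun R _ _ g => Pos R g ∨ Pos' R g) ι p :=
  fun k₀ _ _ _ S _ _ _ _ f hdim hf0 hf2 hpos ν hν x g₁ g₂ q r₁ r₂ hspan hrk hmax hprim =>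
    hpos.elim (fun h₁ => h k₀ S f hdim hf0 hf2 h₁ ν hν x g₁ g₂ q r₁ r₂ hspan hrk hmax hprim)
      (fun h₂ => h' k₀ S f hdim hf0 hf2 h₂ ν hν x g₁ g₂ q r₁ r₂ hspan hrk hmax hprim)

/-- Modus ponens at a position. [folklore] -/
theorem drop (h : KWildHomOf Pos ι p) (k₀ : Type) [Field k₀] [CharP k₀ p] [PerfectField k₀]
    (S : Type) [CommRing S] [Algebra k₀ S] [Algebra.EssFiniteType k₀ S] [IsRegularLocalRing S] (f : S)
    (hdim : ringKrullDim S ≤ 3) (hf0 : f ≠ 0) (hf2 : f ∈ (maximalIdeal S) ^ 2) (hpos : Pos S f)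
    {ν : ℕ} (hν : iotaOrd S f = ν) {x g₁ g₂ : S} {q r₁ r₂ : ℕ}
    (hspan : Ideal.span {x, g₂, g₁} = maximalIdeal S) (hrk : (maximalIdeal S).spanFinrank = 3)
    (hmax : IsSigmaMaximiser f ν g₁ g₂ q r₁ r₂) (hprim : IsPrimitiveTriple q r₁ r₂) :
    WeightedDropHom ι S f (maximalIdeal S) ![x, g₂, g₁] ![q, r₂, r₁] :=
  h k₀ S f hdim hf0 hf2 hpos ν hν x g₁ g₂ q r₁ r₂ hspan hrk hmax hprim

end KWildHomOf

/-- **A tameness-free point drop gives (K-wild-hom)** (restriction seam; the converse is the content of RULING #8's cylinder reduction and is not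
claimed here). [folklore] -/
theorem kWildHomOf_of_pointDropOf_true {Pos : (R : Type) → [CommRing R] → [IsLocalRing R] → R → Prop}
    {ι : (R : Type) → [CommRing R] → R → Ordinal.{0}} {p : ℕ} (h : PointDropOf Pos (fun _ _ _ => True) ι p) : KWildHomOf Pos ι p :=
  fun k₀ _ _ _ S _ _ _ _ f hdim hf0 hf2 hpos ν hν x g₁ g₂ q r₁ r₂ hspan hrk hmax hprim =>
    (h k₀ S f hdim hf0 hf2 hpos trivial ν hν x g₁ g₂ q r₁ r₂ hspan hrk hmax hprim).toHom

end Iota3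

/-! ## (H1) at the door's carrier -/

/-- **(H1) INSTANTIATED**: at a `t`-homogeneous prime of the cobordant algebra over a noetherian `S` whose local ring is regular, there is a regular
system of parameters made of `t`-HOMOGENEOUS elements (p538457 `KWildHom.exists_homogeneous_regularParameters` + p539199's grading).
[OURS · L1 W4.3] -/
theorem exists_homogeneous_regularParameters_cobordant {S : Type} [CommRing S] [IsNoetherianRing S] {n : ℕ} (u : Fin n → S) (w : Fin n → ℕ)
    [IsNoetherianRing (cobordantAlgebra' u w)] (𝔫 : Ideal (cobordantAlgebra' u w)) [𝔫.IsPrime] (h𝔫 : IsTHomogeneous u w 𝔫)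
    [IsRegularLocalRing (Localization.AtPrime 𝔫)] :
    ∃ (d : ℕ) (x : Fin d → cobordantAlgebra' u w), (∀ i, SetLike.IsHomogeneousElem (KWildHom.tGrading u w) (x i)) ∧ (∀ i, x i ∈ 𝔫) ∧
      Ideal.span (Set.range fun i => algebraMap _ (Localization.AtPrime 𝔫) (x i)) = maximalIdeal (Localization.AtPrime 𝔫) ∧
      (d : WithBot ℕ∞) = ringKrullDim (Localization.AtPrime 𝔫) := by
  obtain ⟨inst⟩ := KWildHom.nonempty_gradedRing_tGrading u w
  exact KWildHom.exists_homogeneous_regularParameters _ 𝔫 ((isTHomogeneous_iff_isHomogeneous u w 𝔫).mp h𝔫)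

end Summit.ResolutionOfSingularities.ResolutionOfSingularities.Cruxes.HypersurfaceCentreConstruction.LocalEngine

end
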